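import Literature.NumberTheory.GaloisRepresentations.LocalUnitNorms
import Literature.NumberTheory.GaloisRepresentations.UnramifiedResidueTrace
import HarnessLib

/-!
# The norm on local units above an unramified place is surjective (Childress Lemma 5.3 (a), all places)

Topic `NumberTheory/GaloisRepresentations` (class field theory: Childress, *Class Field Theory*,
Ch. 4 §5 Lemma 5.3 (a) and Prop. 5.7 (iii), PDF pp. 95, 99); namespace
`Literature.NumberTheory.GaloisRepresentations.SemiLocal` (continuing `LocalUnitNorms.lean`).
Everything **proved**.  This removes the "good place" restriction of `LocalUnitNorms.lean`:

* `SemiLocal.exists_unitGroup_norm_eq_of_isUnramifiedIn` — for a finite Galois extension of number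
  fields `E/F` and **any** finite place `v` of `F` unramified in `E`, every `Gal(E/F)`-fixed
  element of `∏_{w∣v} 𝒪_wˣ` is the norm of an element of `∏_{w∣v} 𝒪_wˣ`.  Proof (the unit
  filtration): a fixed unit is `c ∈ 𝒪_vˣ` (descent); modulo `𝔭_v` it is a norm
  (`UnramifiedResidueNorm.lean`); an element of `1 + 𝔭_vᵐ` (`m ≥ 1`) is, modulo `1 + 𝔭_vᵐ⁺¹`, the
  norm `N_{E/F}(1 + ϖᵐβ) = 1 + ϖᵐ Tr β + ϖ²ᵐ r` of a global unit above `v`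
  (`UnramifiedResidueTrace.lean`: `Tr β ≡ c (mod 𝔭_v)` is solvable); and elements close enough to
  `1` are norms by the congruence-subgroup computation of `SemiLocalUnits.lean`
  (`exists_norm_eq_algebraMap_of_norm_sub_one_le`).
* `SemiLocal.exists_unitGroup_twist_eq_of_isUnramifiedIn` — dually, every norm-one element is
  `σy/y` (from `#Ĥ⁰ = #Ĥ⁻¹`).
* `SemiLocal.local_triviality_of_isUnramifiedIn` — the hypotheses `hun₀`, `hun₁` of
  `IdeleClassHerbrand.lean` hold for every finite set `S` containing the ramified places.

## References

* N. Childress, *Class Field Theory*, Universitext, Springer 2009, Ch. 4 §5 Lemma 5.3 (a),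
  Prop. 5.7 (iii) (PDF pp. 95, 99). [Childress2009]
* J. W. S. Cassels, A. Fröhlich (eds.), *Algebraic Number Theory* (1967), Ch. I §7 (unramified
  extensions: the norm on units is surjective). [CasselsFrohlichANT1967]
-/

noncomputable section

open NumberField IsDedekindDomain
open scoped Valued

namespace Literature.NumberTheory.GaloisRepresentations

namespace SemiLocal

open Literature.NumberTheory.Automorphic

universe u

variable {F : Type u} [Field F] [NumberField F] {E : Type u} [Field E] [NumberField E] [Algebra F E]
variable {v : HeightOneSpectrum (𝓞 F)}

/-! ### The second-order expansion of `∏ (1 + t xᵢ)` -/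

omit [NumberField F] [NumberField E] [Algebra F E] in
/-- `∏ᵢ (1 + t xᵢ) = 1 + t ∑ᵢ xᵢ + t² R` in a commutative ring. [folklore] -/
theorem exists_prod_one_add_mul_eq {R : Type*} [CommRing R] {ι : Type*} (s : Finset ι) (t : R) (x : ι → R) :
    ∃ r : R, ∏ i ∈ s, (1 + t * x i) = 1 + t * ∑ i ∈ s, x i + t ^ 2 * r := by
  classical
  induction s using Finset.induction_on with
  | empty => exact ⟨0, by simp⟩
  | insert a s ha ih =>
    obtain ⟨r, hr⟩ := ih
    refine ⟨r + x a * ∑ i ∈ s, x i + t * x a * r, ?_⟩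
    rw [Finset.prod_insert ha, Finset.sum_insert ha, hr]
    ring

/-- **`N_{E/F}(1 + tβ) = 1 + t Tr(β) + t² r` with `r ∈ 𝓞 F`** (`t ∈ 𝓞 F`, `β ∈ 𝓞 E`; the
quadratic remainder is a symmetric function of the conjugates, an algebraic integer of `F`).
[folklore] -/
theorem exists_norm_one_add_mul_eq [IsGalois F E] (t : 𝓞 F) (β : 𝓞 E) :
    ∃ r : 𝓞 F, Algebra.norm F (1 + algebraMap F E (t : F) * (β : E)) =
      1 + (t : F) * Algebra.trace F E (β : E) + (t : F) ^ 2 * (r : F) := by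
  haveI : FiniteDimensional F E := Module.Finite.of_restrictScalars_finite ℚ F E
  obtain ⟨R, hR⟩ := exists_prod_one_add_mul_eq (Finset.univ : Finset (E ≃ₐ[F] E))
    (algebraMap (𝓞 F) (𝓞 E) t) (fun σ => σ • β)
  -- push the identity to `E`
  have hRE : ∏ σ : E ≃ₐ[F] E, (1 + algebraMap F E (t : F) * σ (β : E)) =
      1 + algebraMap F E (t : F) * ∑ σ : E ≃ₐ[F] E, σ (β : E) + algebraMap F E (t : F) ^ 2 * (R : E) := by
    have := congrArg (fun z : 𝓞 E => (z : E)) hR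
    simp only [map_prod, map_add, map_one, map_mul, map_sum, map_pow] at this
    have ht : algebraMap (𝓞 E) E (algebraMap (𝓞 F) (𝓞 E) t) = algebraMap F E (t : F) :=
      (IsScalarTower.algebraMap_apply (𝓞 F) (𝓞 E) E t).symm.trans (IsScalarTower.algebraMap_apply (𝓞 F) F E t)
    have hsmul : ∀ x : E ≃ₐ[F] E, algebraMap (𝓞 E) E (x • β) = x (β : E) := fun x => rfl
    simp only [ht, hsmul] at this
    exact this
  have hnorm : algebraMap F E (Algebra.norm F (1 + algebraMap F E (t : F) * (β : E))) =
      ∏ σ : E ≃ₐ[F] E, (1 + algebraMap F E (t : F) * σ (β : E)) := by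
    rw [Algebra.norm_eq_prod_automorphisms]
    exact Finset.prod_congr rfl fun σ _ => by rw [map_add, map_one, map_mul, AlgEquiv.commutes]
  set u : F := Algebra.norm F (1 + algebraMap F E (t : F) * (β : E)) - 1 - (t : F) * Algebra.trace F E (β : E) with hu
  have hu' : algebraMap F E u = algebraMap F E (t : F) ^ 2 * (R : E) := by
    rw [hu, map_sub, map_sub, map_one, map_mul, hnorm, hRE, trace_eq_sum_automorphisms]; ring
  by_cases ht : (t : F) = 0
  · refine ⟨0, ?_⟩
    have hu0 : u = 0 := (algebraMap F E).injective (by rw [hu', ht, map_zero]; ring)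
    have : Algebra.norm F (1 + algebraMap F E (t : F) * (β : E)) = u + 1 + (t : F) * Algebra.trace F E (β : E) := by
      rw [hu]; ring
    rw [this, hu0, ht]; push_cast; ring
  · -- `u / t²` is integral over `ℤ`
    have hint : IsIntegral ℤ (u / (t : F) ^ 2) := by
      have key : algebraMap F E (u / (t : F) ^ 2) = (R : E) := by
        rw [map_div₀, map_pow, hu', mul_div_cancel_left₀ _ (pow_ne_zero 2 ((map_ne_zero _).mpr ht))]
      have hR : IsIntegral ℤ ((R : 𝓞 E) : E) := RingOfIntegers.isIntegral_coe R
      rw [← key] at hR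
      exact (isIntegral_algebraMap_iff (algebraMap F E).injective).mp hR
    refine ⟨⟨u / (t : F) ^ 2, hint⟩, ?_⟩
    show _ = 1 + (t : F) * Algebra.trace F E (β : E) + (t : F) ^ 2 * (u / (t : F) ^ 2)
    rw [mul_div_cancel₀ _ (pow_ne_zero 2 ht), hu]; ring

/-- The same expansion inside `𝓞 F`. [folklore] -/
theorem exists_int_norm_one_add_mul_eq [IsGalois F E] (t : 𝓞 F) (β : 𝓞 E) :
    ∃ r : 𝓞 F, RingOfIntegers.norm F (1 + algebraMap (𝓞 F) (𝓞 E) t * β) =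
      1 + t * Algebra.intTrace (𝓞 F) (𝓞 E) β + t ^ 2 * r := by
  obtain ⟨r, hr⟩ := exists_norm_one_add_mul_eq (F := F) (E := E) t β
  refine ⟨r, RingOfIntegers.coe_injective ?_⟩
  have hb : (((1 + algebraMap (𝓞 F) (𝓞 E) t * β : 𝓞 E)) : E) = 1 + algebraMap F E (t : F) * (β : E) := by
    rw [RingOfIntegers.coe_eq_algebraMap, map_add, map_one, map_mul, ← IsScalarTower.algebraMap_apply,
      IsScalarTower.algebraMap_apply (𝓞 F) F E]
  show ((RingOfIntegers.norm F (1 + algebraMap (𝓞 F) (𝓞 E) t * β) : 𝓞 F) : F) =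
    ((1 + t * Algebra.intTrace (𝓞 F) (𝓞 E) β + t ^ 2 * r : 𝓞 F) : F)
  rw [RingOfIntegers.coe_norm, hb, hr, RingOfIntegers.coe_eq_algebraMap, RingOfIntegers.coe_eq_algebraMap,
    RingOfIntegers.coe_eq_algebraMap, RingOfIntegers.coe_eq_algebraMap]
  simp only [map_add, map_one, map_mul, map_pow]
  rw [Algebra.algebraMap_intTrace (A := 𝓞 F) (B := 𝓞 E) (K := F) (L := E)]

/-! ### The unit filtration: every level is covered by norms -/

section Filtration

variable [IsGalois F E]

omit [NumberField F] [NumberField E] [IsGalois F E] in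
/-- `ϖ ∈ 𝔭_v ⊆ 𝔓_w` for `w ∣ v`. [folklore] -/
theorem algebraMap_mem_asIdeal_of_mem {ϖ : 𝓞 F} (hϖ : ϖ ∈ v.asIdeal) {w : HeightOneSpectrum (𝓞 E)}
    (hw : w.under (𝓞 F) = v) : algebraMap (𝓞 F) (𝓞 E) ϖ ∈ w.asIdeal := by
  have : ϖ ∈ (w.under (𝓞 F)).asIdeal := by rw [hw]; exact hϖ
  exact this

/-- **The norm on `∏_{w∣v} 𝒪_wˣ` hits every unit of `𝒪_v`** for `v` unramified in the Galois
extension `E/F` (valuation-theoretic form: every `c ∈ 𝒪_vˣ ⊆ F_v` is, diagonally, a norm of an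
element of `∏_{w∣v} 𝒪_wˣ`).  The unit filtration argument of Childress Lemma 5.3 (a), run
with global data. [cite: Childress2009, Ch. 4 §5 Lemma 5.3 (PDF p. 95)] -/
theorem exists_unitGroup_norm_eq_algebraMap_of_isUnramifiedIn (hunr : Algebra.IsUnramifiedIn (𝓞 E) v.asIdeal)
    {c : v.adicCompletion F} (hc1 : Valued.v c = 1) :
    ∃ y ∈ unitGroup F E v, ((Herbrand.norm (E ≃ₐ[F] E) y : (SemiLocal F E v)ˣ) : SemiLocal F E v) =
      algebraMap (v.adicCompletion F) (SemiLocal F E v) c := by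
  classical
  haveI : FiniteDimensional F E := Module.Finite.of_restrictScalars_finite ℚ F E
  -- a global uniformizer
  obtain ⟨ϖ, hϖ⟩ := v.valuation_exists_uniformizer' F
  set ιO := algebraMap (𝓞 F) (v.adicCompletion F) with hιO
  set π : v.adicCompletion F := ιO ϖ with hπdef
  have hπv : Valued.v π = WithZero.exp (-1) := by
    rw [hπdef, hιO, valued_algebraMap_ringOfIntegers, ← HeightOneSpectrum.valuation_of_algebraMap (K := F)]
    exact hϖ
  have hπ1 : Valued.v π < 1 := by rw [hπv, ← WithZero.exp_zero, WithZero.exp_lt_exp]; norm_num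
  have hπ0 : π ≠ 0 := fun h => by rw [h, map_zero] at hπv; exact WithZero.zero_ne_coe hπv
  have hπ : ‖π‖ < 1 := (Valued.toNormedField.norm_lt_one_iff).mpr hπ1
  have hϖmem : ϖ ∈ v.asIdeal := by
    rw [← HeightOneSpectrum.intValuation_lt_one_iff_mem, ← valued_algebraMap_ringOfIntegers v ϖ]
    exact hπ1
  have hπpow : ∀ m : ℕ, Valued.v (π ^ m) = WithZero.exp (-(m : ℤ)) := fun m => by
    rw [map_pow, hπv, ← WithZero.exp_nsmul]; simp
  have hunr' : v.asIdeal.ramificationIdxIn (𝓞 E) = 1 := by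
    obtain ⟨w⟩ := (inferInstance : Nonempty (Place F E v))
    haveI : (w : HeightOneSpectrum (𝓞 E)).asIdeal.IsPrime := (w : HeightOneSpectrum (𝓞 E)).isPrime
    rw [Ideal.ramificationIdxIn_eq_ramificationIdx v.asIdeal (w : HeightOneSpectrum (𝓞 E)).asIdeal (E ≃ₐ[F] E)]
    exact hunr.ramificationIdx_eq_one (Place.liesOver w)
  -- the levels `P m`: every `c ∈ 𝒪_vˣ` with `v(c - 1) ≤ exp(-m)` is a norm from the units
  set P : ℕ → Prop := fun m => ∀ c : v.adicCompletion F, Valued.v c = 1 →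
    Valued.v (c - 1) ≤ WithZero.exp (-(m : ℤ)) →
      ∃ y ∈ unitGroup F E v, ((Herbrand.norm (E ≃ₐ[F] E) y : (SemiLocal F E v)ˣ) : SemiLocal F E v) =
        algebraMap (v.adicCompletion F) (SemiLocal F E v) c with hP
  -- base: deep levels, by the congruence-subgroup computation
  obtain ⟨δ, hδ, hδnorm⟩ := exists_norm_eq_algebraMap_of_norm_sub_one_le (F := F) (E := E) (v := v)
  obtain ⟨n₀, hn₀⟩ := exists_pow_lt_of_lt_one hδ hπ
  set m₀ := max n₀ 1 with hm₀
  have hbase : P m₀ := by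
    intro c _ hcm
    refine hδnorm c ?_
    have h1 : ‖c - 1‖ ≤ ‖π ^ m₀‖ := by
      rw [Valued.toNormedField.norm_le_iff, hπpow]; exact hcm
    refine h1.trans ?_
    rw [norm_pow]
    exact ((pow_le_pow_of_le_one (norm_nonneg _) hπ.le (le_max_left n₀ 1)).trans hn₀.le)
  -- step down: `P (m+1) → P m` for `m ≥ 1`
  have hstep : ∀ m, 1 ≤ m → P (m + 1) → P m := by
    intro m hm IH c hc1 hcm
    -- `c = 1 + π^m c₀`
    set c₀ : v.adicCompletion F := (c - 1) / π ^ m with hc₀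
    have hπm0 : π ^ m ≠ 0 := pow_ne_zero m hπ0
    have hc₀v : Valued.v c₀ ≤ 1 := by
      rw [hc₀, map_div₀, hπpow, div_le_one₀ (by rw [← hπpow]; exact (Valuation.pos_iff _).mpr hπm0)]
      exact hcm
    have hcdec : c = 1 + π ^ m * c₀ := by rw [hc₀, mul_div_cancel₀ _ hπm0]; ring
    -- density and the trace step
    obtain ⟨a, ha⟩ := exists_valued_algebraMap_sub_lt (R := 𝓞 F) (K := F) v (x := c₀) hc₀v hπ0
    set A : v.adicCompletion F := algebraMap (𝓞 F) (v.adicCompletion F) a with hAdef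
    have ha' : Valued.v (A - c₀) < Valued.v π := ha
    obtain ⟨β, hβ⟩ := ResidueTrace.exists_intTrace_sub_mem (E := E) v hunr' a
    set T : v.adicCompletion F := ιO (Algebra.intTrace (𝓞 F) (𝓞 E) β) with hTdef
    have hTa : Valued.v (T - A) ≤ WithZero.exp (-1) := by
      rw [hTdef, hAdef, ← map_sub, valued_algebraMap_ringOfIntegers]
      exact le_exp_neg_one_of_lt_one ((HeightOneSpectrum.intValuation_lt_one_iff_mem _ _).mpr hβ)
    have hTc₀ : Valued.v (T - c₀) ≤ WithZero.exp (-1) := by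
      have : T - c₀ = (T - A) + (A - c₀) := by ring
      rw [this]
      refine (Valuation.map_add _ _ _).trans (max_le hTa ?_)
      rw [← hπv]; exact ha'.le
    -- the global unit `b = 1 + ϖ^m β` and its norm
    set t : 𝓞 F := ϖ ^ m with ht
    obtain ⟨r, hr⟩ := exists_int_norm_one_add_mul_eq (F := F) (E := E) t β
    set b : 𝓞 E := 1 + algebraMap (𝓞 F) (𝓞 E) t * β with hb
    have hbunit : ∀ w : HeightOneSpectrum (𝓞 E), w.under (𝓞 F) = v → b ∉ w.asIdeal := by
      intro w hw hbw
      have htw : algebraMap (𝓞 F) (𝓞 E) t * β ∈ w.asIdeal := by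
        refine w.asIdeal.mul_mem_right _ (algebraMap_mem_asIdeal_of_mem ?_ hw)
        rw [ht]; exact v.asIdeal.pow_mem_of_mem hϖmem m hm
      have h1 : (1 : 𝓞 E) ∈ w.asIdeal := by
        have := w.asIdeal.sub_mem hbw htw
        rwa [hb, add_sub_cancel_right] at this
      exact w.isPrime.ne_top ((Ideal.eq_top_iff_one _).mpr h1)
    have hb0 : (b : E) ≠ 0 := by
      obtain ⟨w⟩ := (inferInstance : Nonempty (Place F E v))
      intro h
      apply hbunit _ w.under_eq
      have : b = 0 := RingOfIntegers.coe_eq_zero_iff.mp h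
      rw [this]; exact Submodule.zero_mem _
    -- `N b` in `F_v` and its distance to `c`
    set Nv : v.adicCompletion F := ((Algebra.norm F (b : E) : F) : v.adicCompletion F) with hNvdef
    have hNvA : Nv = ιO (RingOfIntegers.norm F b) := by rw [hNvdef, ← RingOfIntegers.coe_norm]; rfl
    have hNvexp : Nv = 1 + π ^ m * T + π ^ (2 * m) * ιO r := by
      rw [hNvA, hb, hr]
      simp only [map_add, map_one, map_mul, map_pow]
      rw [← hTdef, ht]
      simp only [map_pow]
      rw [← hπdef]
      ring
    have hρ : Valued.v (ιO r) ≤ 1 := by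
      rw [hιO, valued_algebraMap_ringOfIntegers]
      exact HeightOneSpectrum.intValuation_le_one v r
    have hNvc : Valued.v (Nv - c) ≤ WithZero.exp (-((m + 1 : ℕ) : ℤ)) := by
      have : Nv - c = π ^ m * (T - c₀) + π ^ (2 * m) * ιO r := by
        rw [hNvexp, hcdec]; ring
      rw [this]
      refine (Valuation.map_add _ _ _).trans (max_le ?_ ?_)
      · rw [map_mul, hπpow]
        calc WithZero.exp (-(m : ℤ)) * Valued.v (T - c₀) ≤ WithZero.exp (-(m : ℤ)) * WithZero.exp (-1) :=
              mul_le_mul_right hTc₀ _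
          _ = WithZero.exp (-((m + 1 : ℕ) : ℤ)) := by rw [← WithZero.exp_add]; congr 1; push_cast; ring
      · rw [map_mul, hπpow]
        calc WithZero.exp (-((2 * m : ℕ) : ℤ)) * Valued.v (ιO r)
            ≤ WithZero.exp (-((2 * m : ℕ) : ℤ)) * 1 := mul_le_mul_right hρ _
          _ ≤ WithZero.exp (-((m + 1 : ℕ) : ℤ)) := by
              rw [mul_one, WithZero.exp_le_exp]; push_cast; omega
    have hNvc1 : Valued.v (Nv - c) < 1 := by
      refine hNvc.trans_lt ?_
      rw [← WithZero.exp_zero, WithZero.exp_lt_exp]; push_cast; omega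
    have hNv1 : Valued.v Nv = 1 := by
      have : Nv = c + (Nv - c) := by ring
      rw [this, Valuation.map_add_eq_of_lt_left] <;> rw [hc1]; exact hNvc1
    have hNv0 : Nv ≠ 0 := fun h => by rw [h, map_zero] at hNv1; exact zero_ne_one hNv1
    -- `c' = c / N b` is at level `m + 1`
    set c' : v.adicCompletion F := c / Nv with hc'
    have hc'1 : Valued.v c' = 1 := by rw [hc', map_div₀, hc1, hNv1, div_one]
    have hc'm : Valued.v (c' - 1) ≤ WithZero.exp (-((m + 1 : ℕ) : ℤ)) := by
      have : c' - 1 = (c - Nv) / Nv := by rw [hc', sub_div, div_self hNv0]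
      rw [this, map_div₀, hNv1, div_one, ← Valuation.map_neg, neg_sub]
      exact hNvc
    obtain ⟨y₂, hy₂, hNy₂⟩ := IH c' hc'1 hc'm
    -- assemble with the diagonal unit `b`
    refine ⟨diagUnit (b : E) hb0 * y₂, Subgroup.mul_mem _ (diagUnit_mem_unitGroup b hb0 hbunit) hy₂, ?_⟩
    rw [map_mul, Units.val_mul, val_norm_diagUnit, hNy₂, ← map_mul, ← hNvdef, hc', mul_div_cancel₀ _ hNv0]
  -- all levels `≥ 1`
  have hall : ∀ j, j ≤ m₀ - 1 → P (m₀ - j) := by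
    intro j
    induction j with
    | zero => intro _; simpa using hbase
    | succ j ih =>
      intro hj
      have h1 : 1 ≤ m₀ - (j + 1) := by omega
      have h2 : m₀ - (j + 1) + 1 = m₀ - j := by omega
      exact hstep _ h1 (h2 ▸ ih (by omega))
  have hP1 : P 1 := by
    have := hall (m₀ - 1) le_rfl
    rwa [show m₀ - (m₀ - 1) = 1 by omega] at this
  -- level `0`: the residue norm step
  obtain ⟨a, ha⟩ := exists_valued_algebraMap_sub_lt (R := 𝓞 F) (K := F) v (x := c) hc1.le hπ0
  set A : v.adicCompletion F := algebraMap (𝓞 F) (v.adicCompletion F) a with hAdef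
  have ha' : Valued.v (A - c) < Valued.v π := ha
  have hav : Valued.v A = 1 := by
    have : A = c + (A - c) := by ring
    rw [this, Valuation.map_add_eq_of_lt_left]
    · exact hc1
    · rw [hc1]; exact ha'.trans hπ1
  have hanot : a ∉ v.asIdeal := by
    rw [← HeightOneSpectrum.intValuation_eq_one_iff, ← valued_algebraMap_ringOfIntegers v a]
    exact hav
  obtain ⟨β, hβunit, hβN⟩ := ResidueNorm.exists_norm_sub_mem (E := E) v hunr' a hanot
  have hβ0 : (β : E) ≠ 0 := by
    obtain ⟨w⟩ := (inferInstance : Nonempty (Place F E v))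
    intro h
    apply hβunit _ w.under_eq
    have : β = 0 := RingOfIntegers.coe_eq_zero_iff.mp h
    rw [this]; exact Submodule.zero_mem _
  set Nv : v.adicCompletion F := ((Algebra.norm F (β : E) : F) : v.adicCompletion F) with hNvdef
  have hNvA : Nv = algebraMap (𝓞 F) (v.adicCompletion F) (RingOfIntegers.norm F β) := by
    rw [hNvdef, ← RingOfIntegers.coe_norm]; rfl
  have hNva : Valued.v (Nv - A) ≤ Valued.v π := by
    have hmem : RingOfIntegers.norm F β - a ∈ v.asIdeal := hβN
    rw [hNvA, hAdef, ← map_sub, valued_algebraMap_ringOfIntegers, hπv]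
    exact le_exp_neg_one_of_lt_one ((HeightOneSpectrum.intValuation_lt_one_iff_mem _ _).mpr hmem)
  have hNv1 : Valued.v Nv = 1 := by
    have : Nv = A + (Nv - A) := by ring
    rw [this, Valuation.map_add_eq_of_lt_left]
    · exact hav
    · rw [hav]; exact hNva.trans_lt hπ1
  have hNv0 : Nv ≠ 0 := fun h => by rw [h, map_zero] at hNv1; exact zero_ne_one hNv1
  set x : v.adicCompletion F := c / Nv with hxdef
  have hxv : Valued.v x = 1 := by rw [hxdef, map_div₀, hc1, hNv1, div_one]
  have hx1 : Valued.v (x - 1) ≤ WithZero.exp (-((1 : ℕ) : ℤ)) := by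
    have : x - 1 = (c - Nv) / Nv := by rw [hxdef, sub_div, div_self hNv0]
    rw [this, map_div₀, hNv1, div_one, Nat.cast_one, ← hπv]
    have : c - Nv = (c - A) + (A - Nv) := by ring
    rw [this]
    refine (Valuation.map_add _ _ _).trans (max_le ?_ ?_)
    · rw [← Valuation.map_neg, neg_sub]; exact ha'.le
    · rw [← Valuation.map_neg, neg_sub]; exact hNva
  obtain ⟨y₁, hy₁, hNy₁⟩ := hP1 x hxv hx1
  refine ⟨diagUnit (β : E) hβ0 * y₁, Subgroup.mul_mem _ (diagUnit_mem_unitGroup β hβ0 hβunit) hy₁, ?_⟩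
  rw [map_mul, Units.val_mul, val_norm_diagUnit, hNy₁, ← map_mul, ← hNvdef, hxdef, mul_div_cancel₀ _ hNv0]

/-- **Childress Prop. 5.7 (iii) at every unramified place**: every `Gal(E/F)`-fixed element of
`∏_{w∣v} 𝒪_wˣ` is the norm of an element of `∏_{w∣v} 𝒪_wˣ` (`#Ĥ⁰(G, ∏_{w∣v} 𝒪_wˣ) = 1`).
[cite: Childress2009, Ch. 4 §5 Lemma 5.3 (a), Prop. 5.7 (iii) (PDF pp. 95, 99)] -/
theorem exists_unitGroup_norm_eq_of_isUnramifiedIn (hunr : Algebra.IsUnramifiedIn (𝓞 E) v.asIdeal)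
    {z : (SemiLocal F E v)ˣ} (hz : z ∈ unitGroup F E v) (hfix : ∀ σ : E ≃ₐ[F] E, σ • z = z) :
    ∃ y ∈ unitGroup F E v, Herbrand.norm (E ≃ₐ[F] E) y = z := by
  obtain ⟨c, hc1, hcz⟩ := exists_eq_algebraMap_of_fixed_unit hz hfix
  obtain ⟨y, hy, hNy⟩ := exists_unitGroup_norm_eq_algebraMap_of_isUnramifiedIn hunr hc1
  exact ⟨y, hy, Units.ext (hNy.trans hcz)⟩

/-- **Dually, `#Ĥ⁻¹(G, ∏_{w∣v} 𝒪_wˣ) = 1` at every unramified place** (from `#Ĥ⁰ = #Ĥ⁻¹`,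
`h0_unitGroup_eq_h1`): every norm-one element is `σy/y`. [cite: Childress2009, Ch. 4 §5 Prop. 5.7 (iii) (PDF p. 99)] -/
theorem exists_unitGroup_twist_eq_of_isUnramifiedIn {σ : E ≃ₐ[F] E} (hσ : ∀ τ : E ≃ₐ[F] E, τ ∈ Subgroup.zpowers σ)
    (hunr : Algebra.IsUnramifiedIn (𝓞 E) v.asIdeal)
    {z : (SemiLocal F E v)ˣ} (hz : z ∈ unitGroup F E v) (hN : Herbrand.norm (E ≃ₐ[F] E) z = 1) :
    ∃ y ∈ unitGroup F E v, Herbrand.twist σ y = z := by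
  have h0 : Herbrand.h0 σ (unitGroup F E v) ⊥ = 1 := by
    rw [Herbrand.h0_eq_one_iff]
    intro x hx hfix
    rw [Subgroup.mem_bot, div_eq_one] at hfix
    obtain ⟨y, hy, hyx⟩ := exists_unitGroup_norm_eq_of_isUnramifiedIn hunr hx
      ((Herbrand.forall_smul_eq_iff hσ).mpr hfix)
    rw [Herbrand.b0_bot]
    exact ⟨y, hy, hyx⟩
  have h1 : Herbrand.h1 σ (unitGroup F E v) ⊥ = 1 := by
    rw [← (h0_unitGroup_eq_h1 (F := F) (E := E) (v := v) hσ).1, h0]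
  have := (Herbrand.h1_eq_one_iff.mp h1) z hz (by rw [Subgroup.mem_bot]; exact hN)
  rw [Herbrand.b1_bot] at this
  obtain ⟨y, hy, hyz⟩ := this
  exact ⟨y, hy, hyz⟩

/-- **The local triviality hypotheses `hun₀`, `hun₁` for any finite set containing the ramified
places.** [cite: Childress2009, Ch. 4 §5 Prop. 5.7 (iii) (PDF p. 99)] -/
theorem local_triviality_of_isUnramifiedIn {σ : E ≃ₐ[F] E} (hσ : ∀ τ : E ≃ₐ[F] E, τ ∈ Subgroup.zpowers σ)
    (S : Finset (HeightOneSpectrum (𝓞 F)))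
    (hS : ∀ v ∉ S, Algebra.IsUnramifiedIn (𝓞 E) v.asIdeal) :
    (∀ v ∉ S, ∀ z ∈ unitGroup F E v, (∀ g : E ≃ₐ[F] E, g • z = z) →
        ∃ y ∈ unitGroup F E v, Herbrand.norm (E ≃ₐ[F] E) y = z) ∧
      (∀ v ∉ S, ∀ z ∈ unitGroup F E v, Herbrand.norm (E ≃ₐ[F] E) z = 1 →
        ∃ y ∈ unitGroup F E v, Herbrand.twist σ y = z) :=
  ⟨fun v hv _ hz hfix => exists_unitGroup_norm_eq_of_isUnramifiedIn (hS v hv) hz hfix,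
    fun v hv _ hz hN => exists_unitGroup_twist_eq_of_isUnramifiedIn hσ (hS v hv) hz hN⟩

end Filtration

end SemiLocal

end Literature.NumberTheory.GaloisRepresentations
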